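import Literature.Geometry.Riemannian.AlmostNonnegRicciFibrationEquivLimit
import HarnessLib

/-!
# Huang–Huang–Wang–Zhu 2026, Main Theorem 1 at `n = 4`, `b₁ = 1`: the remaining core, split into
the volume-comparison input and the analysis of the equivariant limit

Tenth reduction file for the named fact
`Literature.Geometry.Riemannian.huangHuangWangZhu2026_fibresOverCircle_four`. The sequential form
of the remaining analytic core (`huangHuangWangZhu2026_fibresOverCircle_four_of_seq_le_one`,
`AlmostNonnegRicciFibrationSequential.lean`) asks, for every `κ > 0` and every contradiction
sequence `D : (i : ℕ) → CoreDatum κ (δ i)`, `0 < δᵢ ≤ 1`, `δᵢ → 0`, that some `Dᵢ` be good. The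
metric skeleton of the printed proof (§4 p. 13: covers, diagram (4.1)) is in the tree CONDITIONAL on
uniform covering bounds for the balls of the covers (`AlmostNonnegRicciFibrationPrecompact.lean`,
`AlmostNonnegRicciFibrationEquivLimit.lean`), which for complete `4`-manifolds with `Ric ≥ -δᵢ ĝᵢ`,
`δᵢ ≤ 1`, is the Bishop–Gromov relative volume comparison theorem (Huang–Huang–Wang–Zhu 2026, §2,
"by volume comparison"; not in the tree). This file names that property and splits the remaining
core accordingly:

* `CoreDatum.UniformlyCoveredBalls D p̂` — the covering-bound property of the covers of a sequence
  of data (a predicate, the hypothesis `hcov` of the previous files);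
* `huangHuangWangZhu2026_fibresOverCircle_four_of_volumeComparison_of_limitCore` — **the fact
  follows from (BG) "the covers of every contradiction sequence have uniformly covered balls" and
  (LIM) "along every contradiction sequence with uniformly covered balls some datum is good"**;
  under (BG)+`UniformlyCoveredBalls` the tree supplies the proper geodesic limit `Y` with lines,
  its abelian cocompact limit group `H` and the equivariant convergence
  (`CoreDatum.exists_strictMono_pointedEquivGHConv`, `CoreDatum.ultralimit_exists_line`, …), so
  (LIM) is exactly the analysis of that limit: the almost splitting `Y = ℝ × Ŷ` (Cheeger–Colding /
  Gigli), Thm 1.11 (equivariant smooth almost submersions) and Thm 2.9 (non-degeneracy from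
  `sec ≥ -κ`) of the source.

Conditional reduction only: (BG) and (LIM) are hypotheses, not named facts; one predicate with body;
no debt change.

## References

* H. Huang, X.-T. Huang, J. Wang, X. Zhu, arXiv:2605.24380 (2026), §2 (volume comparison,
  Thm 2.1), Thm 1.11, Thm 2.9, §4 pp. 13–14. [HuangHuangWangZhu2026]
-/

noncomputable section

open scoped Manifold ContDiff Topology
open Function Set Filter Metric

namespace Literature.Geometry.Riemannian

open Literature.Geometry.MetricGeometry Literature.Topology.FourManifolds.CircleMaps

namespace CoreDatum

variable {κ : ℝ} {δ : ℕ → ℝ}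

/-- **Uniformly covered balls** of the covers of a sequence of data with base points `p̂ᵢ`: for all
`R` and `ε > 0` the balls `B̄(p̂ᵢ, R) ⊆ M̂ᵢ` contain `ε`-dense subsets of cardinality bounded
independently of `i` — the hypothesis `hcov` of `AlmostNonnegRicciFibrationPrecompact.lean`, i.e.
what Bishop–Gromov volume comparison on the complete covers with `Ric ≥ -δᵢ ĝᵢ`, `δᵢ ≤ 1`,
delivers ("by volume comparison", Huang–Huang–Wang–Zhu 2026, §2).
[cite: HuangHuangWangZhu2026, §2.1 p. 6 Thm 2.1 and §4 p. 13] -/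
def UniformlyCoveredBalls (D : (i : ℕ) → CoreDatum κ (δ i)) (p : ∀ i, (D i).Cover) : Prop :=
  letI := coverMetricSpaces D
  ∀ (R ε : ℝ), 0 < ε → ∃ N : ℕ, ∀ i, ∃ S : Finset ((D i).Cover), S.card ≤ N ∧
    ∀ x ∈ closedBall (p i) R, ∃ s ∈ S, dist x s ≤ ε

/-- Unfolding lemma. [cite: HuangHuangWangZhu2026, §2.1 p. 6] -/
theorem uniformlyCoveredBalls_iff (D : (i : ℕ) → CoreDatum κ (δ i)) (p : ∀ i, (D i).Cover) :
    UniformlyCoveredBalls D p ↔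
      letI := coverMetricSpaces D
      ∀ (R ε : ℝ), 0 < ε → ∃ N : ℕ, ∀ i, ∃ S : Finset ((D i).Cover), S.card ≤ N ∧
        ∀ x ∈ closedBall (p i) R, ∃ s ∈ S, dist x s ≤ ε :=
  Iff.rfl

/-- **What uniformly covered balls buy** (summary of the previous files): a subsequence of the
covers with their deck groups converges in the pointed equivariant Gromov–Hausdorff sense to the
proper ultralimit with its abelian limit group moving every point into the unit ball about the base
point, and the limit is geodesic, noncompact, with a line within distance `1` of the base point.
[cite: HuangHuangWangZhu2026, §2.1 p. 6 Thm 2.1 and §4 p. 13] -/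
theorem UniformlyCoveredBalls.limit_package {D : (i : ℕ) → CoreDatum κ (δ i)}
    {p : ∀ i, (D i).Cover} (h : UniformlyCoveredBalls D p) :
    letI := coverMetricSpaces D
    ProperSpace (Ultralimit p (hyperfilter ℕ)) ∧
      (∃ φ : ℕ → ℕ, StrictMono φ ∧
        PointedEquivGHConv (X := fun n ↦ (D (φ n)).Cover) (fun _ ↦ Multiplicative ℤ)
          (deckLimitGroup D p) (fun n ↦ p (φ n)) (Ultralimit.basePt p (hyperfilter ℕ))) ∧
      (∀ A ∈ deckLimitGroup D p, ∀ B ∈ deckLimitGroup D p, A * B = B * A) ∧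
      (∀ y : Ultralimit p (hyperfilter ℕ), ∃ A ∈ deckLimitGroup D p,
        dist (A y) (Ultralimit.basePt p (hyperfilter ℕ)) ≤ 1) ∧
      (∃ σ : ℝ → Ultralimit p (hyperfilter ℕ), Isometry σ ∧
        dist (σ 0) (Ultralimit.basePt p (hyperfilter ℕ)) ≤ 1) ∧
      NoncompactSpace (Ultralimit p (hyperfilter ℕ)) := by
  obtain ⟨hP, hconv⟩ := exists_strictMono_pointedEquivGHConv D p h
  exact ⟨hP, hconv, deckLimitGroup_mul_comm D p, exists_mem_deckLimitGroup_dist_basePt_le_one D p,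
    ultralimit_exists_line D p h, ultralimit_noncompactSpace D p h⟩

end CoreDatum

/-- **The remaining core split in two** (conditional reduction): the named fact
`huangHuangWangZhu2026_fibresOverCircle_four` follows from
(BG) — the covers of every contradiction sequence have uniformly covered balls (Bishop–Gromov on the
complete covers with `Ric ≥ -δᵢ ĝᵢ`, `δᵢ ≤ 1`: "by volume comparison"), and
(LIM) — along every contradiction sequence whose covers have uniformly covered balls some datum is
good (the analysis of the equivariant limit supplied by `UniformlyCoveredBalls.limit_package`:
almost splitting, Thm 1.11, Thm 2.9 of the source).
[cite: HuangHuangWangZhu2026, §2.1 p. 6 Thm 2.1, Thm 1.11, Thm 2.9 and §4 pp. 13–14] -/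
theorem huangHuangWangZhu2026_fibresOverCircle_four_of_volumeComparison_of_limitCore
    (hBG : ∀ (κ : ℝ) (δ : ℕ → ℝ) (D : (i : ℕ) → CoreDatum κ (δ i)) (p : ∀ i, (D i).Cover),
      0 < κ → (∀ i, 0 < δ i) → (∀ i, δ i ≤ 1) → CoreDatum.UniformlyCoveredBalls D p)
    (hLIM : ∀ κ : ℝ, 0 < κ → ∀ δ : ℕ → ℝ, (∀ i, 0 < δ i) → (∀ i, δ i ≤ 1) →
      Tendsto δ atTop (𝓝 0) → ∀ (D : (i : ℕ) → CoreDatum κ (δ i)) (p : ∀ i, (D i).Cover),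
        CoreDatum.UniformlyCoveredBalls D p → ∃ i, (D i).Good) :
    huangHuangWangZhu2026_fibresOverCircle_four := by
  refine huangHuangWangZhu2026_fibresOverCircle_four_of_seq_le_one fun κ hκ δ hδ hδ1 hδ0 D ↦ ?_
  -- base points on the (connected, hence nonempty) covers
  have hne : ∀ i, Nonempty ((D i).Cover) := fun i ↦ (D i).hconn.toNonempty
  set p : ∀ i, (D i).Cover := fun i ↦ Classical.choice (hne i) with hp
  exact hLIM κ hκ δ hδ hδ1 hδ0 D p (hBG κ δ D p hκ hδ hδ1)

end Literature.Geometry.Riemannian
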